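import Summits.AnomalousDissipation.AnomalousDissipation.Theorems.BaireTransferRobustLoudUpgradeLinePeriodicDefs
import Summits.AnomalousDissipation.AnomalousDissipation.Theorems.BaireTransferRobustLoudUpgradeStubLsFoldPeriodic

/-!
# Line `malkin-cone-group-orbits`, companion c3: the FOLD OF CYCLES class and the extended line glue

Definitions + glue (reviewed for the definition).  `foldPeriodic` packages the hypotheses of the landed
`LsFamilyPeriodic.stub_lsFoldPeriodic` (a genuinely time-dependent periodic witness with strict budgets whose free-period linearisation is
simply degenerate, an INTRINSICALLY transversal fold — every real kernel pair `(w, β')` has `(w·∇)w − β' ∂ₜw` outside the range of the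
free-period linearisation — and one first-order-visible force direction `d ∈ P_S`; no isolation, no symmetry: the saddle-node of cycles,
the generic codimension-one degeneracy of a periodic orbit, which with `ν` free fills OPEN cones of `P_S`);
`foldPeriodic ⊆ robustCrossingPeriodic ⊆ closure (interior LOUD)`; `tamePeriodic2 := tamePeriodic ∪ foldPeriodic`; `line_glue_c3b` (registered):
the residual over `tamePeriodic2` proves the crux BY NAME.  References: Kielhöfer 2012 §I.12–I.13; Chow–Hale 1982 Ch. 9; Iooss 1972.
-/

-- `Summit.<Summit>.<Problem>` is the tree's mandated summit-side namespace (CONVENTIONS §2); for this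
-- single-conjunct summit the two coincide, so the duplicate is deliberate.
set_option linter.dupNamespace false

noncomputable section

open scoped BigOperators Topology
open Filter Set Function TopologicalSpace MeasureTheory

namespace Summit.AnomalousDissipation.AnomalousDissipation.Theorems.RobustLoudUpgrade

open Literature.Analysis.FunctionSpaces Literature.Analysis.FunctionSpaces.Torus
open Literature.Analysis.FluidPDE
open Summit.AnomalousDissipation.AnomalousDissipation.Theses.BaireTransfer

/-- **Transversal folds of cycles in the force family** (concrete member of `robustCrossingPeriodic`; periodic twin of `foldSteady`).
`c` carries, at some `ν ∈ (0,a)`, a genuinely time-dependent `τ`-periodic classical witness `u` with STRICT budgets whose free-period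
linearisation is SIMPLY degenerate: every periodic solution of the problem forced by a multiple of `∂ₜu` is a combination of `∂ₜu` and ONE
real admissible `τ`-periodic field `v` which is not a multiple of `∂ₜu` (the multiplier `1` is double); the FOLD is TRANSVERSAL, intrinsically:
for every real kernel pair `(w, β')` — `w` a real smooth `τ`-periodic solution of the problem forced by `β' ∂ₜu`, not a multiple of `∂ₜu` —
the second-order term `(w·∇)w − β' ∂ₜw` is not in the range of the free-period linearisation (no periodic solution of the problem forced by
`β ∂ₜu + [(w·∇)w − β' ∂ₜw]`, for any `β`); and ONE force direction `d ∈ P_S` is first-order visible (no periodic solution of the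
problem forced by `β ∂ₜu + f_d`).  No isolation, no symmetry.  (Kielhöfer 2012 §I.12–I.13, the saddle-node of cycles; Chow–Hale 1982 Ch. 9;
Iooss 1972.) [folklore] -/
def foldPeriodic (S : Finset (Fin 3 → ℤ)) (a E ε : ℝ) : Set (Coeff S) :=
  {c | ∃ ν : ℝ, 0 < ν ∧ ν < a ∧ ∃ (τ : ℝ) (u : ℝ → UnitAddTorus (Fin 3) → EuclideanSpace ℝ (Fin 3))
      (p : ℝ → UnitAddTorus (Fin 3) → ℝ), 0 < τ ∧
    IsClassicalNSSolutionOn Set.univ ν (fun _ => force S c) u p ∧ Function.Periodic u τ ∧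
      meanEnergy u < E ∧ ε < meanDissipation ν u ∧ (∃ t x, Torus.timeDerivWithin Set.univ u t x ≠ 0) ∧
      ∃ (v : ℝ → UnitAddTorus (Fin 3) → EuclideanSpace ℝ (Fin 3)) (d : Coeff S),
        IsSmoothSpaceTimeOn Set.univ v ∧ Function.Periodic v τ ∧ (∀ t, IsDivFree (v t)) ∧ (∀ t, HasZeroMean (v t)) ∧
        (¬ ∃ z : ℂ, ∀ t x, Torus.realToComplex (v t x) = z • velocityDot u t x) ∧
        (∀ (w : ℝ → UnitAddTorus (Fin 3) → EuclideanSpace ℂ (Fin 3)) (β : ℂ),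
          w ∈ linPeriodicSol ν u τ (fun t x => β • velocityDot u t x) →
            ∃ z₁ z₂ : ℂ, ∀ t x, w t x = z₁ • velocityDot u t x + z₂ • Torus.realToComplex (v t x)) ∧
        (∀ (wr : ℝ → UnitAddTorus (Fin 3) → EuclideanSpace ℝ (Fin 3)) (β' : ℝ),
          IsSmoothSpaceTimeOn Set.univ wr → Function.Periodic wr τ →
          (fun t x => Torus.realToComplex (wr t x)) ∈ linPeriodicSol ν u τ (fun t x => (β' : ℂ) • velocityDot u t x) →
          (¬ ∃ z : ℂ, ∀ t x, Torus.realToComplex (wr t x) = z • velocityDot u t x) →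
          ∀ β : ℂ, linPeriodicSol ν u τ (fun t x => β • velocityDot u t x +
            Torus.realToComplex (Torus.convect (wr t) (wr t) x - β' • Torus.timeDerivWithin Set.univ wr t x)) = ∅) ∧
        (∀ β : ℂ, linPeriodicSol ν u τ (fun t x => β • velocityDot u t x + cplx (force S d) x) = ∅)}

/-- The tame union of the companion c3, extended by the folds of cycles. [folklore] -/
def tamePeriodic2 (S : Finset (Fin 3 → ℤ)) (a E ε : ℝ) : Set (Coeff S) :=
  tamePeriodic S a E ε ∪ foldPeriodic S a E ε

namespace LsCrossingPeriodic

/-- **`foldPeriodic ⊆ robustCrossingPeriodic`** (registered sub-goal `foldPeriodic_subset_robust`, from `stub_lsFoldPeriodic`). [folklore] -/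
theorem foldPeriodic_subset_robust : ∀ (S : Finset (Fin 3 → ℤ)) (a E ε : ℝ), foldPeriodic S a E ε ⊆ robustCrossingPeriodic S a E ε := by
  intro S a E ε c hc
  obtain ⟨ν, hν, hνa, τ, u, p, hτ, hsol, hper, hE, hε, hmov, v, d, hsv, hperv, hvdiv, hv0, hdeg, hker, hfold, hvis⟩ := hc
  obtain ⟨σ, hfam, hsign⟩ := LsFamilyPeriodic.stub_lsFoldPeriodic S c d ν τ u p v hν hτ hsol hper hmov hsv hperv hvdiv hv0 hdeg hker hfold hvis
  exact ⟨ν, hν, hνa, τ, u, p, hτ, hsol, hper, hE, hε, σ, hfam, hsign⟩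

/-- **`foldPeriodic ⊆ closure (interior LOUD)`**: transversal folds of cycles are limits of robustly loud forces. [folklore] -/
theorem foldPeriodic_subset_closure_interior_loud (S : Finset (Fin 3 → ℤ)) (a E ε : ℝ) :
    foldPeriodic S a E ε ⊆ closure (interior (loud S a E ε)) :=
  (foldPeriodic_subset_robust S a E ε).trans (robustCrossingPeriodic_subset_closure_interior_loud S a E ε)

/-- **The extended tame union is force-open up to closure.** [folklore] -/
theorem tamePeriodic2_subset_closure_interior_loud (S : Finset (Fin 3 → ℤ)) (a E ε : ℝ) :
    tamePeriodic2 S a E ε ⊆ closure (interior (loud S a E ε)) :=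
  Set.union_subset (tamePeriodic_subset_closure_interior_loud S a E ε) (foldPeriodic_subset_closure_interior_loud S a E ε)

/-- **Extended line glue of the companion c3 (registered sub-goal `line_glue_c3b`)**: the residual over `tamePeriodic2` proves the crux
`RobustLoudUpgrade` BY NAME. [folklore] -/
theorem line_glue_c3b : (∀ S : Finset (Fin 3 → ℤ), unitStock ⊆ S → ∀ (a E ε : ℝ), 0 < a → 0 < ε → loud S a E ε ⊆ closure (tamePeriodic2 S a (2 * E) (ε / 2))) → RobustLoudUpgrade :=
  fun hRes => LsCrossing.RobustLoudUpgrade_of_residual (fun S a E ε => tamePeriodic2 S a E ε)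
    tamePeriodic2_subset_closure_interior_loud hRes

end LsCrossingPeriodic

end Summit.AnomalousDissipation.AnomalousDissipation.Theorems.RobustLoudUpgrade

end
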